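import Summits.PneNP.PneNP.Theses.PrimalityPlaces
import Literature.Computability.MetaComplexity.PolynomialCalculusKnapsack

/-!
# Crux attack on `PrimalityPlaces.CarryFreeKnapsackDegree` (stmt-PneNP-16925) — positive side

Finding (refuter, crux-attack at birth): the crux is a COROLLARY of the vendored named fact
`PC.ImpagliazzoPudlakSgall1999_knapsack_degree` (IPS99 / FSTW16 Thm. 90, general coefficients):
the Boolean restriction `y := e_m` (i.e. `y_j := 0` for `j < m`, `y_m := 1`) and `x_m := 1` is an
algebra map that sends PC-derivations to PC-derivations without raising the degree, and sends the
bilinear system `{Σ 2^(i+j) x_i y_j − p, x_m − 1, y_m − 1}` to the single knapsack axiom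
`Σ_{i<m} 2^(i+m) x_i − (p − 4^m)` whose target is odd while every subset sum is even; IPS99 gives
degree `≥ ⌈m/2⌉ + 1 ≥ n/2`, hence `≥ (1/4)·n/log n` for `n ≥ 4`.
Candidate proof for a prover (refuters do not land positive Theses statements).
-/

set_option linter.dupNamespace false

namespace Summit.PneNP.PneNP.Cruxes.CarryFreeKnapsackDegree.Attack

open MvPolynomial
open scoped BigOperators
open Literature.Computability.MetaComplexity

/-- A substitution by polynomials of degree `≤ 1` does not raise the total degree. [folklore] -/
theorem totalDegree_bind₁_le_of_le_one {σ τ R : Type*} [CommSemiring R]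
    {h : σ → MvPolynomial τ R} (hh : ∀ v, (h v).totalDegree ≤ 1) (p : MvPolynomial σ R) :
    (bind₁ h p).totalDegree ≤ p.totalDegree := by
  classical
  conv_lhs => rw [p.as_sum, map_sum]
  refine (totalDegree_finsetSum _ _).trans (Finset.sup_le fun m hm => ?_)
  rw [bind₁_monomial]
  refine (totalDegree_mul _ _).trans ?_
  rw [totalDegree_C, zero_add]
  refine (totalDegree_finsetProd _ _).trans ?_
  calc ∑ v ∈ m.support, (h v ^ m v).totalDegree ≤ ∑ v ∈ m.support, m v :=
        Finset.sum_le_sum fun v _ => (totalDegree_pow _ _).trans (by have := hh v; nlinarith)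
    _ = m.sum fun _ e => e := rfl
    _ ≤ p.totalDegree := le_totalDegree hm

/-- **Boolean substitutions map PC-derivations to PC-derivations of no larger degree.**
If every variable is sent to `0`, `1` or a variable, then a degree-`≤ d` derivation from `𝓕`
becomes a degree-`≤ d` derivation from any `𝓖` deriving the images of the axioms (`d ≥ 2` so that
Boolean axioms stay available, and `0` derivable from `𝓖` to absorb the killed Boolean axioms).
[folklore; Impagliazzo–Pudlák–Sgall 1999 (restrictions)] -/
theorem derivable_bind₁ {σ τ F : Type*} [Field F] (g : σ → MvPolynomial τ F)
    (hg : ∀ i, g i = 0 ∨ g i = 1 ∨ ∃ j, g i = X j)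
    {𝓕 : Set (MvPolynomial σ F)} {𝓖 : Set (MvPolynomial τ F)} {d : ℕ} (hd : 2 ≤ d)
    (hz : PC.DerivableInDegree 𝓖 d 0)
    (h𝓕 : ∀ f ∈ 𝓕, f.totalDegree ≤ d → PC.DerivableInDegree 𝓖 d (bind₁ g f))
    {f : MvPolynomial σ F} (h : PC.DerivableInDegree 𝓕 d f) :
    PC.DerivableInDegree 𝓖 d (bind₁ g f) := by
  have hg1 : ∀ v, (g v).totalDegree ≤ 1 := by
    intro v
    rcases hg v with h0 | h1 | ⟨j, hj⟩
    · rw [h0, totalDegree_zero]; exact Nat.zero_le _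
    · rw [h1, totalDegree_one]; exact Nat.zero_le _
    · rw [hj, totalDegree_X]
  induction h with
  | hyp hf hdeg => exact h𝓕 _ hf hdeg
  | booleanAxiom i _ =>
      rw [map_sub, map_pow, bind₁_X_right]
      rcases hg i with h0 | h1 | ⟨j, hj⟩
      · rw [h0]; simpa using hz
      · rw [h1]; simpa using hz
      · rw [hj]
        refine .booleanAxiom j (le_trans ?_ hd)
        refine (totalDegree_sub _ _).trans (max_le ?_ ?_)
        · exact (totalDegree_pow _ _).trans (by rw [totalDegree_X])
        · rw [totalDegree_X]; norm_num
  | add _ _ ihf ihg => rw [map_add]; exact .add ihf ihg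
  | mul h' _ hdeg ih =>
      rw [map_mul]
      refine .mul _ ih ?_
      rw [← map_mul]
      exact (totalDegree_bind₁_le_of_le_one hg1 _).trans hdeg

/-- The restriction `x_i ↦ x_i (i < m)`, `x_m ↦ 1`, `y_j ↦ 0 (j < m)`, `y_m ↦ 1`. -/
noncomputable def g (m : ℕ) : Fin (m + 1) ⊕ Fin (m + 1) → MvPolynomial (Fin m) ℚ
  | Sum.inl i => if h : i = Fin.last m then 1 else X (i.castPred h)
  | Sum.inr j => if j = Fin.last m then 1 else 0

theorem hg (m : ℕ) : ∀ v, g m v = 0 ∨ g m v = 1 ∨ ∃ j, g m v = X j := by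
  rintro (i | j)
  · by_cases h : i = Fin.last m
    · exact Or.inr (Or.inl (by simp [g, h]))
    · exact Or.inr (Or.inr ⟨i.castPred h, by simp [g, h]⟩)
  · by_cases h : j = Fin.last m
    · exact Or.inr (Or.inl (by simp [g, h]))
    · exact Or.inl (by simp [g, h])

/-- Knapsack coefficients after restriction: `2^(i+m)`. -/
noncomputable def α (m : ℕ) : Fin m → ℚ := fun i => 2 ^ ((i : ℕ) + m)

/-- Knapsack target after restriction: `p − 4^m`. -/
noncomputable def β (m p : ℕ) : ℚ := (p : ℚ) - 2 ^ (m + m)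

/-- The image of the bilinear axiom is the knapsack axiom. -/
theorem bind₁_P (m p : ℕ) :
    bind₁ (g m) ((∑ i : Fin (m + 1), ∑ j : Fin (m + 1),
        C ((2 : ℚ) ^ (i.1 + j.1)) * X (Sum.inl i) * X (Sum.inr j)) - C (p : ℚ)) =
      (∑ i : Fin m, C (α m i) * X i) - C (β m p) := by
  rw [map_sub, bind₁_C_right, map_sum]
  have inner : ∀ i : Fin (m + 1),
      bind₁ (g m) (∑ j : Fin (m + 1), C ((2 : ℚ) ^ (i.1 + j.1)) * X (Sum.inl i) * X (Sum.inr j)) =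
        C ((2 : ℚ) ^ (i.1 + m)) * g m (Sum.inl i) := by
    intro i
    rw [map_sum, Finset.sum_eq_single_of_mem (Fin.last m) (Finset.mem_univ _)]
    · rw [map_mul, map_mul, bind₁_C_right, bind₁_X_right, bind₁_X_right]
      simp [g]
    · intro j _ hj
      rw [map_mul, map_mul, bind₁_X_right, bind₁_X_right]
      simp [g, hj]
  simp_rw [inner]
  rw [Fin.sum_univ_castSucc]
  have hlast : g m (Sum.inl (Fin.last m)) = 1 := by simp [g]
  have hcast : ∀ i : Fin m, g m (Sum.inl (Fin.castSucc i)) = X i := by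
    intro i; simp [g, Fin.castSucc_ne_last]
  simp_rw [hcast, hlast]
  simp only [Fin.val_castSucc, Fin.val_last, mul_one, α, β, map_sub C]
  ring

/-- Every subset sum of the restricted coefficients misses the restricted target (parity:
the sums are even, `p − 4^m` is odd for an odd prime `p ≥ 4^m`, `m ≥ 1`). -/
theorem beta_not_subset_sum {m p : ℕ} (hm : 1 ≤ m) (hp : p.Prime) (hlo : 4 ^ m ≤ p)
    (S : Finset (Fin m)) : ∑ i ∈ S, α m i ≠ β m p := by
  intro hS
  simp only [α, β] at hS
  have hS' : ((∑ i ∈ S, 2 ^ ((i : ℕ) + m) + 2 ^ (m + m) : ℕ) : ℚ) = (p : ℚ) := by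
    push_cast; linarith
  have hnat : ∑ i ∈ S, 2 ^ ((i : ℕ) + m) + 2 ^ (m + m) = p := by exact_mod_cast hS'
  have h2 : 2 ∣ p := by
    rw [← hnat]
    refine dvd_add (Finset.dvd_sum fun i _ => ?_) ?_
    · exact dvd_pow_self 2 (by omega)
    · exact dvd_pow_self 2 (by omega)
  have hp2 : p = 2 := by
    rcases (Nat.Prime.eq_one_or_self_of_dvd hp 2 h2) with h | h
    · omega
    · exact h.symm
  have h4 : 4 ^ 1 ≤ 4 ^ m := Nat.pow_le_pow_right (by norm_num) hm
  omega

/-- **The crux follows from the Impagliazzo–Pudlák–Sgall knapsack degree bound.**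
(`c = 1/4`, `N = 4`.) -/
theorem carryFreeKnapsackDegree_of_IPS99
    (hIPS : PC.ImpagliazzoPudlakSgall1999_knapsack_degree) :
    Summit.PneNP.PneNP.Theses.PrimalityPlaces.CarryFreeKnapsackDegree := by
  refine ⟨1 / 4, by norm_num, 4, ?_⟩
  intro n hn p hp hlo hhi m hmn
  dsimp only
  intro d hd
  subst hmn
  have hm3 : 3 ≤ m := by omega
  rw [Nat.add_sub_cancel] at hlo
  -- the restricted system
  set K : MvPolynomial (Fin m) ℚ := (∑ i : Fin m, C (α m i) * X i) - C (β m p) with hK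
  have hKdeg : K.totalDegree ≤ 1 := by
    refine (totalDegree_sub _ _).trans (max_le ?_ ?_)
    · refine totalDegree_finsetSum_le fun i _ => ?_
      exact (totalDegree_mul _ _).trans (by rw [totalDegree_C, totalDegree_X])
    · rw [totalDegree_C]; exact Nat.zero_le _
  have hd2 : 2 ≤ max d 2 := le_max_right _ _
  have hKhyp : PC.DerivableInDegree ({K} : Set (MvPolynomial (Fin m) ℚ)) (max d 2) K :=
    .hyp (Set.mem_singleton _) (hKdeg.trans (le_trans (by norm_num) hd2))
  have hz : PC.DerivableInDegree ({K} : Set (MvPolynomial (Fin m) ℚ)) (max d 2) 0 := by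
    have := PC.DerivableInDegree.mul 0 hKhyp (by simp)
    rwa [mul_zero] at this
  have href : PC.RefutableInDegree ({K} : Set (MvPolynomial (Fin m) ℚ)) (max d 2) := by
    have h1 := derivable_bind₁ (g m) (hg m) hd2 hz ?_ (PC.DerivableInDegree.mono (le_max_left d 2) hd)
    · unfold PC.RefutableInDegree
      rwa [map_one] at h1
    · intro f hf _
      simp only [Set.mem_insert_iff, Set.mem_singleton_iff] at hf
      rcases hf with rfl | rfl | rfl
      · rw [bind₁_P]; exact hKhyp
      · have : bind₁ (g m) (X (Sum.inl (Fin.last m)) - 1 : MvPolynomial _ ℚ) = 0 := by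
          rw [map_sub, bind₁_X_right, map_one]; simp [g]
        rw [this]; exact hz
      · have : bind₁ (g m) (X (Sum.inr (Fin.last m)) - 1 : MvPolynomial _ ℚ) = 0 := by
          rw [map_sub, bind₁_X_right, map_one]; simp [g]
        rw [this]; exact hz
  have hα : ∀ i, α m i ≠ 0 := fun i => pow_ne_zero _ two_ne_zero
  have hβ : ∀ S : Finset (Fin m), ∑ i ∈ S, α m i ≠ β m p :=
    fun S => beta_not_subset_sum (by omega) hp hlo S
  have hb : (m + 1) / 2 + 1 ≤ max d 2 := hIPS ℚ m (α m) (β m p) hα hβ (max d 2) href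
  have hdm : (m + 1) / 2 + 1 ≤ d := by
    rcases Nat.le_total d 2 with h | h
    · rw [max_eq_right h] at hb; omega
    · rwa [max_eq_left h] at hb
  have h2d : m + 2 ≤ 2 * d := by omega
  -- real arithmetic
  have hn2 : (2 : ℝ) ≤ ((m + 1 : ℕ) : ℝ) := by exact_mod_cast (by omega : 2 ≤ m + 1)
  have hlog : (1 / 2 : ℝ) ≤ Real.log ((m + 1 : ℕ) : ℝ) := by
    have h := Real.log_le_log (by norm_num) hn2
    have h2 := Real.log_two_gt_d9
    linarith
  have hlogpos : 0 < Real.log ((m + 1 : ℕ) : ℝ) := by linarith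
  have hdr : (((m + 1 : ℕ) : ℝ) + 1) / 2 ≤ (d : ℝ) := by
    have : ((m + 2 : ℕ) : ℝ) ≤ ((2 * d : ℕ) : ℝ) := by exact_mod_cast h2d
    push_cast at this ⊢
    linarith
  rw [div_le_iff₀ hlogpos]
  calc 1 / 4 * ((m + 1 : ℕ) : ℝ) ≤ ((((m + 1 : ℕ) : ℝ) + 1) / 2) * (1 / 2) := by
        have : (0 : ℝ) ≤ ((m + 1 : ℕ) : ℝ) := by positivity
        linarith
    _ ≤ (d : ℝ) * Real.log ((m + 1 : ℕ) : ℝ) :=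
        mul_le_mul hdr hlog (by norm_num) (by positivity)

end Summit.PneNP.PneNP.Cruxes.CarryFreeKnapsackDegree.Attack
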